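import Mathlib
import Summits.CriticalPhenomena.CardyFormulaZ2.Theorems.CardyMagicRigidityPositiveConeJointDefs
import Summits.CriticalPhenomena.CardyFormulaZ2.Theorems.CardyMagicRigidityNestingRigidityTowerCountMeasurable
import Summits.CriticalPhenomena.CardyFormulaZ2.Theorems.CardyMagicRigidityNestingRigidityTowerPressureSanity
import Summits.CriticalPhenomena.CardyFormulaZ2.Theorems.CardyMagicRigidityNestingRigidityPgfIdentity
import Summits.CriticalPhenomena.CardyFormulaZ2.Theorems.CardyMagicRigidityNestingRigidityPgfUniqueness
import HarnessLib

/-!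
# Stub `stub_jointPgfUniqueness` (line `positive-cone-weight-doubling`, crux `NestingRigidity`)

Crux `Summit.CriticalPhenomena.CardyFormulaZ2.Theses.CardyMagicRigidity.NestingRigidity`
(stmt-CriticalPhenomena-4835), line `positive-cone-weight-doubling`, registered stub
`stub_jointPgfUniqueness : ∀ J n x r R, JointTiltAgreementAt J n x r R → JointLawAgreementAt J n x r R`
(STUB 4' of the reshaped skeleton r4): the JOINT (multi-family) form of the landed
`stub_pgfUniqueness` (`CardyMagicRigidityNestingRigidityPgfUniqueness`).  If the positively tilted
JOINT multi-disc pattern-count moments `E_δ[∏_j ∏_{S ≠ ∅} (u j S)^{N^j_S}]` of bond-`ℤ²` and site-`𝕋`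
are eventually bounded and asymptotically equal (`δ → 0⁺`) for all weight families `u` in a
non-empty open set of positive families, then every JOINT cylinder probability of the concatenated
count vector `(N^j_S)_{j < J, S ≠ ∅}` is asymptotically equal on the two lattices.

The proof is the single-family one re-indexed by the finite type `Fin J × nonemptyParts n`:

* §1 `jointTilt_eq_tsum` — at positive mesh the joint tilted moment is the generating function
  `Σ_κ P[N = κ] ∏_i (u i.1 i.2)^{κ i}` of the cylinder probabilities of the concatenated count vector
  `N : Ω → ℕ^{Fin J × nonemptyParts n}` (pattern counts are bounded at positive mesh,
  `exists_patternCount_le`; `integral_prod_pow_eq_tsum`); `setOf_forall_forall_nonempty_eq` — the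
  event of `jointCyl` is the corresponding cylinder event;
* §2 the stub: along every sequence `δ_j → 0⁺` (`Filter.tendsto_of_seq_tendsto`) the two families of
  cylinder probabilities are `[0,1]`-valued coefficient families on `ℕ^{Fin J × nonemptyParts n}`
  whose generating functions are eventually bounded and asymptotically equal on the open set
  `{v | ext v ∈ U}` (weights extended off the non-empty parts by a fixed `u₀ ∈ U`, which the joint
  tilt does not see); the landed analytic core `tendsto_coeff_sub_of_tsum`
  (`CardyMagicRigidityNestingRigidityPgfIdentity`) gives coefficientwise asymptotic agreement.
-/

noncomputable section

open MeasureTheory Set Filter Metric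
open scoped Real Topology BigOperators ENNReal

namespace Summit.CriticalPhenomena.CardyFormulaZ2.Cruxes.NestingRigidity.PositiveConeWeightDoubling

open Literature.Probability.RandomPlanarGeometry Literature.Probability.Percolation
  Literature.Probability.LatticeModels
open Summit.CriticalPhenomena.CardyFormulaZ2.Theses.CardyMagicRigidity
open Summit.CriticalPhenomena.CardyFormulaZ2.Cruxes.NestingRigidity.RingCloudTomography

/-! ## §1 Joint tilted moments are generating functions of joint cylinder probabilities -/

/-- **The joint tilted moment is the generating function of the joint cylinder probabilities** of
the concatenated count vector `(N^j_S)_{(j, S) ∈ Fin J × nonemptyParts n}`, at every positive mesh,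
on both lattice ensembles (and the coefficient family is summable against every weight family). -/
theorem jointTilt_eq_tsum : ∀ E ∈ latticeEnsembles, ∀ {δ : ℝ}, 0 < δ →
    ∀ {J n : ℕ} (x : Fin J → Fin n → ℂ) (r : Fin J → Fin n → ℝ) (R : Fin J → ℝ)
      (w : Fin J → Finset (Fin n) → ℝ),
      Summable (fun κ : Fin J × nonemptyParts n → ℕ ↦ (E.P {ω | ∀ i : Fin J × nonemptyParts n,
          patternCount (E.X δ ω) (x i.1) (r i.1) (R i.1) i.2 = κ i}).toReal *
            ∏ i : Fin J × nonemptyParts n, w i.1 i.2 ^ κ i) ∧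
        jointTilt E x r R w δ = ∑' κ : Fin J × nonemptyParts n → ℕ,
          (E.P {ω | ∀ i : Fin J × nonemptyParts n,
            patternCount (E.X δ ω) (x i.1) (r i.1) (R i.1) i.2 = κ i}).toReal *
              ∏ i : Fin J × nonemptyParts n, w i.1 i.2 ^ κ i := by
  intro E hE δ hδ J n x r R w
  haveI : IsProbabilityMeasure E.P := isProbabilityMeasure_of_mem hE
  choose C hC using fun j : Fin J ↦ exists_patternCount_le E hE hδ (R j)
  have h := integral_prod_pow_eq_tsum E.P (N := fun ω (i : Fin J × nonemptyParts n) ↦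
    patternCount (E.X δ ω) (x i.1) (r i.1) (R i.1) i.2)
    (fun i ↦ measurable_patternCount E hE δ (x i.1) (r i.1) (R i.1) i.2)
    (C := Finset.univ.sup C)
    (fun ω i ↦ (hC i.1 ω (x i.1) (r i.1) i.2).trans (Finset.le_sup (Finset.mem_univ i.1)))
    (fun i ↦ w i.1 i.2)
  refine ⟨h.1, ?_⟩
  rw [← h.2, jointTilt]
  refine integral_congr_ae (Eventually.of_forall fun ω ↦ ?_)
  simp only
  rw [Fintype.prod_prod_type]
  exact Finset.prod_congr rfl fun j _ ↦ (Finset.prod_coe_sort (nonemptyParts n)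
    (fun S ↦ w j S ^ patternCount (E.X δ ω) (x j) (r j) (R j) S)).symm

/-- The event of `jointCyl` (quantified over `j` and non-empty `S`) is the cylinder event of the
concatenated count vector indexed by `Fin J × nonemptyParts n`. -/
theorem setOf_forall_forall_nonempty_eq {α : Type*} {J n : ℕ} (Q : α → Fin J → Finset (Fin n) → Prop) :
    {ω | ∀ j : Fin J, ∀ S : Finset (Fin n), S.Nonempty → Q ω j S} =
      {ω | ∀ i : Fin J × nonemptyParts n, Q ω i.1 i.2} := by
  ext ω
  simp only [Set.mem_setOf_eq, nonemptyParts, Finset.mem_filter, Finset.mem_univ, true_and,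
    Prod.forall, Subtype.forall]

/-! ## §2 The stub -/

/-- **STUB 4' · joint PGF uniqueness in limit form** (registered stub of line
`positive-cone-weight-doubling`): if the positively tilted JOINT multi-disc pattern-count moments of
bond-`ℤ²` and site-`𝕋` at `J` disc families are eventually bounded and asymptotically equal, as
`δ → 0⁺`, for all weight families in a non-empty open set of positive families, then every joint
cylinder probability of `(N^j_S)_{j < J, S ≠ ∅}` is asymptotically equal.  Proof: reduce to sequences
`δ_m → 0⁺`; by §1 the joint tilted moments are the generating functions `Σ_κ P[N = κ] v^κ` of the
`[0,1]`-valued joint cylinder probabilities (weights indexed by `Fin J × nonemptyParts n`, extended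
to all index sets by a fixed `u₀ ∈ U` off the non-empty ones — the joint tilt does not see those
coordinates); the landed analytic core `tendsto_coeff_sub_of_tsum` concludes. -/
theorem stub_jointPgfUniqueness :
    ∀ (J n : ℕ) (x : Fin J → Fin n → ℂ) (r : Fin J → Fin n → ℝ) (R : Fin J → ℝ),
      JointTiltAgreementAt J n x r R → JointLawAgreementAt J n x r R := by
  intro J n x r R hT k
  obtain ⟨U, hUo, ⟨u₀, hu₀⟩, hUpos, hU⟩ := hT
  classical
  -- weight families indexed by `Fin J × nonemptyParts n`, extended by `u₀` elsewhere
  set ext : (Fin J × nonemptyParts n → ℝ) → (Fin J → Finset (Fin n) → ℝ) :=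
    fun v j S ↦ if h : S ∈ nonemptyParts n then v (j, ⟨S, h⟩) else u₀ j S with hext
  have hext_cont : Continuous ext := continuous_pi fun j ↦ continuous_pi fun S ↦ by
    by_cases h : S ∈ nonemptyParts n
    · simp only [hext, dif_pos h]; exact continuous_apply _
    · simp only [hext, dif_neg h]; exact continuous_const
  have hext_apply : ∀ (v : Fin J × nonemptyParts n → ℝ) (i : Fin J × nonemptyParts n),
      ext v i.1 i.2 = v i := fun v i ↦ by
    simp only [hext, dif_pos i.2.2, Subtype.coe_eta, Prod.mk.eta]
  set U' : Set (Fin J × nonemptyParts n → ℝ) := ext ⁻¹' U with hU'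
  have hU'o : IsOpen U' := hUo.preimage hext_cont
  have hU'ne : U'.Nonempty := by
    have hv₀ : ext (fun i ↦ u₀ i.1 i.2) = u₀ := by
      funext j S
      simp only [hext]
      split_ifs <;> rfl
    exact ⟨fun i ↦ u₀ i.1 i.2, Set.mem_preimage.2 (by rw [hv₀]; exact hu₀)⟩
  have hU'pos : ∀ v ∈ U', ∀ i, 0 < v i := fun v hv i ↦ by
    rw [← hext_apply v i]; exact hUpos _ hv _ _
  -- along a sequence of meshes `δs m → 0⁺`
  refine tendsto_of_seq_tendsto fun δs hδs ↦ ?_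
  have hpos : ∀ᶠ m in atTop, δs m ∈ Ioi (0 : ℝ) := hδs.eventually eventually_mem_nhdsWithin
  -- the joint cylinder probabilities as coefficient families
  set a : ℕ → (Fin J × nonemptyParts n → ℕ) → ℝ := fun m κ ↦ (zEns.P {ω |
    ∀ i : Fin J × nonemptyParts n,
      patternCount (zEns.X (δs m) ω) (x i.1) (r i.1) (R i.1) i.2 = κ i}).toReal with ha
  set b : ℕ → (Fin J × nonemptyParts n → ℕ) → ℝ := fun m κ ↦ (tEns.P {ω |
    ∀ i : Fin J × nonemptyParts n,
      patternCount (tEns.X (δs m) ω) (x i.1) (r i.1) (R i.1) i.2 = κ i}).toReal with hb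
  haveI : IsProbabilityMeasure zEns.P := isProbabilityMeasure_of_mem zEns_mem
  haveI : IsProbabilityMeasure tEns.P := isProbabilityMeasure_of_mem tEns_mem
  have hle1 : ∀ {Ω : Type} [MeasurableSpace Ω] (P : Measure Ω) [IsProbabilityMeasure P]
      (s : Set Ω), (P s).toReal ≤ 1 :=
    fun P _ s ↦ (ENNReal.toReal_mono ENNReal.one_ne_top prob_le_one).trans_eq ENNReal.toReal_one
  -- generating functions = joint tilted moments at positive mesh
  have hgen : ∀ v : Fin J × nonemptyParts n → ℝ, ∀ᶠ m in atTop,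
      (Summable (fun κ ↦ a m κ * ∏ i, v i ^ κ i) ∧
          jointTilt zEns x r R (ext v) (δs m) = ∑' κ, a m κ * ∏ i, v i ^ κ i) ∧
        (Summable (fun κ ↦ b m κ * ∏ i, v i ^ κ i) ∧
          jointTilt tEns x r R (ext v) (δs m) = ∑' κ, b m κ * ∏ i, v i ^ κ i) := by
    intro v
    filter_upwards [hpos] with m hm
    have hZ := jointTilt_eq_tsum zEns zEns_mem hm x r R (ext v)
    have hT := jointTilt_eq_tsum tEns tEns_mem hm x r R (ext v)
    simp only [hext_apply] at hZ hT
    exact ⟨hZ, hT⟩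
  have key := tendsto_coeff_sub_of_tsum (a := a) (b := b) (fun m κ ↦ ENNReal.toReal_nonneg)
    (fun m κ ↦ ENNReal.toReal_nonneg) (fun m κ ↦ hle1 _ _) (fun m κ ↦ hle1 _ _) hU'o hU'ne hU'pos
    (fun v hv ↦ ?_) (fun v hv ↦ ?_) (fun i ↦ k i.1 i.2)
  · -- conclusion: `jointCyl` is the coefficient at `κ = fun i ↦ k i.1 i.2`
    have hfun : (fun δ ↦ jointCyl zEns x r R k δ - jointCyl tEns x r R k δ) ∘ δs =
        fun m ↦ a m (fun i ↦ k i.1 i.2) - b m (fun i ↦ k i.1 i.2) := by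
      funext m
      simp only [Function.comp_apply, jointCyl, ha, hb]
      rw [setOf_forall_forall_nonempty_eq
          (fun ω j S ↦ patternCount (zEns.X (δs m) ω) (x j) (r j) (R j) S = k j S),
        setOf_forall_forall_nonempty_eq
          (fun ω j S ↦ patternCount (tEns.X (δs m) ω) (x j) (r j) (R j) S = k j S)]
    rw [hfun]
    exact key
  · -- eventual bounds
    obtain ⟨M, hM⟩ := (hU (ext v) hv).1
    refine ⟨M, ?_⟩
    filter_upwards [hδs.eventually hM, hgen v] with m hm hg
    exact ⟨⟨hg.1.1, hg.1.2 ▸ hm.1⟩, ⟨hg.2.1, hg.2.2 ▸ hm.2⟩⟩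
  · -- asymptotic equality
    refine ((hU (ext v) hv).2.comp hδs).congr' ?_
    filter_upwards [hgen v] with m hg
    rw [Function.comp_apply, hg.1.2, hg.2.2]

end Summit.CriticalPhenomena.CardyFormulaZ2.Cruxes.NestingRigidity.PositiveConeWeightDoubling

end
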